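import Literature.AlgebraicGeometry.ModuliOfAbelianVarieties.SiegelFamilyProductLociMumfordTateGroup
import Literature.NumberTheory.ComplexMultiplication.SiegelCMPointsDegreeOneMumfordTateGroup
import HarnessLib

/-!
# The Mumford–Tate group on the product locus `𝔥₁ × 𝔥₁ → 𝔥₂` with NON-ISOGENOUS elliptic blocks:
# `MT(X_{(τ₁ 0; 0 τ₂)})(ℝ) = {reindex_ε (A 0; 0 B) : A ∈ MT(X_{τ₁})(ℝ), B ∈ MT(X_{τ₂})(ℝ), det A = det B}` (Moonen Exercise 5.6)

Layer `Literature/AlgebraicGeometry/ModuliOfAbelianVarieties`, namespace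
`Literature.AlgebraicGeometry.ModuliOfAbelianVarieties.SiegelModuli`; lane `lit-hodgefound` (Track 2 foundations
library, Layer A1 «Mumford–Tate groups of the members of the Siegel family»), prover seat p17, generation 30,
self-proposed row g30-#13 — the EQUALITY case of g30-#11 (`SiegelFamilyProductLociMumfordTateGroup`: on the product locus
`MT(X_{(Z₁ 0; 0 Z₂)}) ⊆ {reindex_ε (A 0; 0 B) : det(A)^{2g₂} = det(B)^{2g₁}}`, strict as soon as `Hom_ℚ(X_{Z₁}, X_{Z₂}) ≠ 0`) for two
elliptic blocks `τ₁, τ₂ ∈ 𝔥₁` with `X_{τ₁} ≁ X_{τ₂}`: then the fibre product over the determinants IS attained — the Kaehler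
layer's Moonen Exercise (5.6) for `E_{τ₁} × E_{τ₂}` (`mem_mumfordTateGroup_prod_ellipticPeriod_iff_of_not_isIsogenous`, p17: all four
combinations of `End⁰(Eᵢ) ∈ {ℚ, Kᵢ}`; Lombardo's case 5 «`MT ≅ 𝔾_m · (M₁ × M₂)`») relabelled from the index `Fin 2 ⊕ Fin 2` of
`E_{τ₁} × E_{τ₂}` to `(Fin 1 ⊕ Fin 1) ⊕ (Fin 1 ⊕ Fin 1)` (g30-#12 `hodgeS_prinPeriod_one_eq_reindex`, `mem_mumfordTateGroup_prinPeriod_one_iff`)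
and then to the coordinates `(λ, μ)` of `𝔥₂` (g30-#11 `mem_mumfordTateGroup_prinPeriod_blockDiagPoint_iff`).  THEOREMS ONLY: no
definition, no instance, no named fact, nothing conditional (D-0026, net debt 0).

## Sources, verbatim

* B. Moonen, *An introduction to Mumford–Tate groups* (2004), §5 (5.6) Exercise (p. 12): «Consider a product `X = E₁ × E₂` of two
  elliptic curves … In each case, try to determine the Mumford-Tate group of `X`»; §4 Lemma 4.6.
* D. Lombardo, *Computing the geometric endomorphism ring of a genus-2 Jacobian*, Math. Comp. 88 (2019), §2.2 case 5
  (arXiv:1610.09674 p. 4): «… the product of two non-isogenous elliptic curves … The Mumford-Tate group has rank 3, and it is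
  isomorphic to `𝔾_m · (M₁ × M₂)`».
* H. Imai, *On the Hodge groups of some abelian varieties*, Kōdai Math. Sem. Rep. 27 (1976), §2 Proposition (p. 368).
* J. Carlson, S. Müller-Stach, C. Peters, *Period Mappings and Period Domains* (2nd ed. 2017), §15.2 Problem 15.2.3 (a),
  Examples 15.2.4 (ii).

## What is proved (`e : Fin 1 ⊕ Fin 1 ≃ Fin 2`, `ε` with g30-#3's compatibilities `h₁–h₄`, `Z₁, Z₂ ∈ 𝔥₁`)

* §1 (private) relabelling both blocks of a block sum; `hodgeS_prod_prinPeriod_one_eq_reindex`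
  (`h_{X_{Z₁} × X_{Z₂}}(z) = reindex_θ h_{E_{τ₁} × E_{τ₂}}(z)`), `mem_mumfordTateGroup_prod_prinPeriod_one_iff`
  (`MT(X_{Z₁} × X_{Z₂})(ℝ) = reindex_θ MT(E_{τ₁} × E_{τ₂})(ℝ)`).
* §2 **`mem_mumfordTateGroup_prinPeriod_blockDiagPoint_one_one_iff_of_not_isIsogenous`**: for `X_{Z₁} ≁ X_{Z₂}`,
  `N ∈ MT(X_{(τ₁ 0; 0 τ₂)})(ℝ) ⟺ N = reindex_ε (A 0; 0 B)` with `A ∈ MT(X_{Z₁})(ℝ)`, `B ∈ MT(X_{Z₂})(ℝ)` and `det A = det B`;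
  `reindex_fromBlocks_mem_mumfordTateGroup_prinPeriod_blockDiagPoint_of_not_isIsogenous` (every such block sum IS in the
  Mumford–Tate group).

## Proof route / deviation

Three relabellings composed (`Fin 2 → Fin 1 ⊕ Fin 1` on each block, then `ε`), each an instance of GGK (I.B.4) for a
coordinate permutation (`IsPolyGroupIso.mem_mumfordTateGroup_iff` for `reindexPolyMap`); the mathematics is the Kaehler
layer's.  The isogenous case (`X_{τ₁} ∼ X_{τ₂}`: strict, `reindex_ε (1 0; 0 −1) ∉ MT`) is g30-#11's rider and is not restated.

## References

* [Moonen2004MT] B. Moonen, *An introduction to Mumford–Tate groups* (2004), §5 (5.6) Exercise, §4 Lemma 4.6. [cite: Moonen2004MT, §5 (5.6) Exercise (p. 12)]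
* [Lombardo2019] D. Lombardo, *Computing the geometric endomorphism ring of a genus-2 Jacobian*, Math. Comp. 88 (2019),
  889–929, §2.2 case 5. [cite: Lombardo2019, §2.2, case 5 (arXiv:1610.09674 p. 4)]
* [Imai1976HodgeGroups] H. Imai, *On the Hodge groups of some abelian varieties*, Kōdai Math. Sem. Rep. 27 (1976), §2
  Proposition. [cite: Imai1976HodgeGroups, §2 Proposition (p. 368)]
* [CarlsonMullerStachPeters2017] J. Carlson, S. Müller-Stach, C. Peters, *Period Mappings and Period Domains*, §15.2
  Problem 15.2.3 (a). [cite: CarlsonMullerStachPeters2017, §15.2 Problem 15.2.3 (a)]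
-/

noncomputable section

open scoped Matrix Classical
open Matrix Function Set Module

namespace Literature.AlgebraicGeometry.ModuliOfAbelianVarieties

namespace SiegelModuli

open Literature.NumberTheory.Automorphic
open Literature.NumberTheory.ModularForms Literature.NumberTheory.ModularForms.SiegelUpperHalfSpace
open Literature.NumberTheory.ComplexMultiplication Literature.NumberTheory.ComplexMultiplication.SiegelCMPoint
open Literature.Geometry.Kaehler Literature.Geometry.Kaehler.ComplexTorus

variable {g : ℕ}

/-! ## §1 Relabelling both blocks: `X_{Z₁} × X_{Z₂}` versus `E_{τ₁} × E_{τ₂}` -/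

section Dictionary

/-- `reindex_{η ⊕ κ} (A 0; 0 D) = (reindex_η A 0; 0 reindex_κ D)`. [folklore] -/
private theorem reindex_sumCongr_fromBlocks_zero {α α' β β' R : Type*} [Zero R] (η : α ≃ α') (κ : β ≃ β')
    (A : Matrix α α R) (D : Matrix β β R) :
    Matrix.reindex (η.sumCongr κ) (η.sumCongr κ) (fromBlocks A 0 0 D) =
      fromBlocks (Matrix.reindex η η A) 0 0 (Matrix.reindex κ κ D) := by
  ext i j
  rcases i with i | i <;> rcases j with j | j <;> rfl

variable (Z₁ Z₂ : siegelUpperHalfSpace 1)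

/-- **`h_{X_{Z₁} × X_{Z₂}}(z) = reindex_θ h_{E_{τ₁} × E_{τ₂}}(z)`**, `θ = e ⊕ e`, `e : Fin 2 ≃ Fin 1 ⊕ Fin 1`.
[cite: Moonen2004MT, §4 Lemma 4.6] [cite: Lange2023AbelianVarietiesComplex, §7.1.1 Prop. 7.1.1] -/
theorem hodgeS_prod_prinPeriod_one_eq_reindex (z : ℂ) :
    hodgeS (prodPeriod (prinPeriod Z₁) (prinPeriod Z₂)) z =
      Matrix.reindex ((finSumFinEquiv (m := 1) (n := 1)).symm.sumCongr (finSumFinEquiv (m := 1) (n := 1)).symm)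
        ((finSumFinEquiv (m := 1) (n := 1)).symm.sumCongr (finSumFinEquiv (m := 1) (n := 1)).symm)
        (hodgeS (prodPeriod (ellipticPeriod (im_apply_pos Z₁).ne') (ellipticPeriod (im_apply_pos Z₂).ne')) z) := by
  rw [hodgeS_prodPeriod, hodgeS_prodPeriod, hodgeS_prinPeriod_one_eq_reindex Z₁, hodgeS_prinPeriod_one_eq_reindex Z₂,
    reindex_sumCongr_fromBlocks_zero]

/-- **`MT(X_{Z₁} × X_{Z₂})(ℝ) = reindex_θ MT(E_{τ₁} × E_{τ₂})(ℝ)`** on elements. [cite: GreenGriffithsKerr2012, §I.B (I.B.4) (p. 39)]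
[cite: Moonen2004MT, §4 (4.1)] -/
theorem mem_mumfordTateGroup_prod_prinPeriod_one_iff {M : GL ((Fin 1 ⊕ Fin 1) ⊕ (Fin 1 ⊕ Fin 1)) ℝ} :
    M ∈ mumfordTateGroup (prodPeriod (prinPeriod Z₁) (prinPeriod Z₂)) ↔
      ∃ P ∈ mumfordTateGroup (prodPeriod (ellipticPeriod (im_apply_pos Z₁).ne') (ellipticPeriod (im_apply_pos Z₂).ne')),
        Matrix.reindex ((finSumFinEquiv (m := 1) (n := 1)).symm.sumCongr (finSumFinEquiv (m := 1) (n := 1)).symm)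
            ((finSumFinEquiv (m := 1) (n := 1)).symm.sumCongr (finSumFinEquiv (m := 1) (n := 1)).symm)
            (P : Matrix (Fin 2 ⊕ Fin 2) (Fin 2 ⊕ Fin 2) ℝ) =
          (M : Matrix ((Fin 1 ⊕ Fin 1) ⊕ (Fin 1 ⊕ Fin 1)) ((Fin 1 ⊕ Fin 1) ⊕ (Fin 1 ⊕ Fin 1)) ℝ) := by
  rw [(isPolyGroupIso_reindexPolyMap _).mem_mumfordTateGroup_iff
    (Φ := prodPeriod (ellipticPeriod (im_apply_pos Z₁).ne') (ellipticPeriod (im_apply_pos Z₂).ne'))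
    (Φ' := prodPeriod (prinPeriod Z₁) (prinPeriod Z₂)) (fun _ _ _ h ↦ h.elim)
    (fun z _ ↦ by rw [peval_reindexPolyMap, hodgeS_prod_prinPeriod_one_eq_reindex Z₁ Z₂])]
  simp only [peval_reindexPolyMap]

end Dictionary

/-! ## §2 Moonen Exercise (5.6) on the product locus `𝔥₁ × 𝔥₁ → 𝔥₂`, non-isogenous blocks -/

section NonIsogenous

variable (e : Fin 1 ⊕ Fin 1 ≃ Fin g) (Z₁ Z₂ : siegelUpperHalfSpace 1)
  {ε : (Fin 1 ⊕ Fin 1) ⊕ (Fin 1 ⊕ Fin 1) ≃ Fin g ⊕ Fin g}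

/-- **MOONEN EXERCISE (5.6) / LOMBARDO CASE 5 IN THE COORDINATES `(λ, μ)`: for `X_{Z₁} ≁ X_{Z₂}` (`Zᵢ ∈ 𝔥₁`),
`N ∈ MT(X_{(τ₁ 0; 0 τ₂)})(ℝ) ⟺ N = reindex_ε (A 0; 0 B)` with `A ∈ MT(X_{Z₁})(ℝ)`, `B ∈ MT(X_{Z₂})(ℝ)` and `det A = det B`**
(«`MT ≅ 𝔾_m · (M₁ × M₂)`»: the fibre product over the determinant characters is attained).
[cite: Moonen2004MT, §5 (5.6) Exercise (p. 12)] [cite: Lombardo2019, §2.2, case 5 (arXiv:1610.09674 p. 4)]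
[cite: CarlsonMullerStachPeters2017, §15.2 Problem 15.2.3 (a)] -/
theorem mem_mumfordTateGroup_prinPeriod_blockDiagPoint_one_one_iff_of_not_isIsogenous
    (h₁ : ∀ i, ε (Sum.inl (Sum.inl i)) = Sum.inl (e (Sum.inl i))) (h₂ : ∀ i, ε (Sum.inl (Sum.inr i)) = Sum.inr (e (Sum.inl i)))
    (h₃ : ∀ j, ε (Sum.inr (Sum.inl j)) = Sum.inl (e (Sum.inr j))) (h₄ : ∀ j, ε (Sum.inr (Sum.inr j)) = Sum.inr (e (Sum.inr j)))
    (hiso : ¬ IsIsogenous (prinPeriod Z₁) (prinPeriod Z₂)) {N : GL (Fin g ⊕ Fin g) ℝ} :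
    N ∈ mumfordTateGroup (prinPeriod (blockDiagPoint e Z₁ Z₂)) ↔
      ∃ A ∈ mumfordTateGroup (prinPeriod Z₁), ∃ B ∈ mumfordTateGroup (prinPeriod Z₂),
        (A : Matrix (Fin 1 ⊕ Fin 1) (Fin 1 ⊕ Fin 1) ℝ).det = (B : Matrix (Fin 1 ⊕ Fin 1) (Fin 1 ⊕ Fin 1) ℝ).det ∧
          (N : Matrix (Fin g ⊕ Fin g) (Fin g ⊕ Fin g) ℝ) =
            Matrix.reindex ε ε (fromBlocks (A : Matrix _ _ ℝ) 0 0 (B : Matrix _ _ ℝ)) := by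
  have hiso' : ¬ IsIsogenous (ellipticPeriod (im_apply_pos Z₁).ne') (ellipticPeriod (im_apply_pos Z₂).ne') :=
    fun h ↦ hiso ((isIsogenous_prinPeriod_one_iff Z₁ Z₂).2 h)
  rw [mem_mumfordTateGroup_prinPeriod_blockDiagPoint_iff e Z₁ Z₂ h₁ h₂ h₃ h₄]
  constructor
  · rintro ⟨M, hM, hMN⟩
    obtain ⟨P, hP, hPM⟩ := (mem_mumfordTateGroup_prod_prinPeriod_one_iff Z₁ Z₂).1 hM
    obtain ⟨A', hA', B', hB', hdet, rfl⟩ :=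
      (mem_mumfordTateGroup_prod_ellipticPeriod_iff_of_not_isIsogenous _ _ hiso').1 hP
    obtain ⟨A, hAA'⟩ : ∃ A : GL (Fin 1 ⊕ Fin 1) ℝ, (A : Matrix (Fin 1 ⊕ Fin 1) (Fin 1 ⊕ Fin 1) ℝ) =
        Matrix.reindex (finSumFinEquiv (m := 1) (n := 1)).symm (finSumFinEquiv (m := 1) (n := 1)).symm
          (A' : Matrix (Fin 2) (Fin 2) ℝ) :=
      ⟨Matrix.GeneralLinearGroup.mk'' _ (by rw [Matrix.det_reindex_self]; exact (Matrix.isUnit_iff_isUnit_det _).1 A'.isUnit),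
        rfl⟩
    obtain ⟨B, hBB'⟩ : ∃ B : GL (Fin 1 ⊕ Fin 1) ℝ, (B : Matrix (Fin 1 ⊕ Fin 1) (Fin 1 ⊕ Fin 1) ℝ) =
        Matrix.reindex (finSumFinEquiv (m := 1) (n := 1)).symm (finSumFinEquiv (m := 1) (n := 1)).symm
          (B' : Matrix (Fin 2) (Fin 2) ℝ) :=
      ⟨Matrix.GeneralLinearGroup.mk'' _ (by rw [Matrix.det_reindex_self]; exact (Matrix.isUnit_iff_isUnit_det _).1 B'.isUnit),
        rfl⟩
    refine ⟨A, (mem_mumfordTateGroup_prinPeriod_one_iff Z₁).2 ⟨A', hA', hAA'.symm⟩,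
      B, (mem_mumfordTateGroup_prinPeriod_one_iff Z₂).2 ⟨B', hB', hBB'.symm⟩, ?_, ?_⟩
    · rw [hAA', hBB', Matrix.det_reindex_self, Matrix.det_reindex_self, hdet]
    · rw [← hMN, ← hPM, coe_blockDiagGL, reindex_sumCongr_fromBlocks_zero, hAA', hBB']
  · rintro ⟨A, hA, B, hB, hdet, hN⟩
    obtain ⟨A', hA', hA'A⟩ := (mem_mumfordTateGroup_prinPeriod_one_iff Z₁).1 hA
    obtain ⟨B', hB', hB'B⟩ := (mem_mumfordTateGroup_prinPeriod_one_iff Z₂).1 hB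
    have hdet' : (A' : Matrix (Fin 2) (Fin 2) ℝ).det = (B' : Matrix (Fin 2) (Fin 2) ℝ).det := by
      rw [← Matrix.det_reindex_self (finSumFinEquiv (m := 1) (n := 1)).symm (A' : Matrix (Fin 2) (Fin 2) ℝ),
        ← Matrix.det_reindex_self (finSumFinEquiv (m := 1) (n := 1)).symm (B' : Matrix (Fin 2) (Fin 2) ℝ), hA'A, hB'B, hdet]
    have hP := (mem_mumfordTateGroup_prod_ellipticPeriod_iff_of_not_isIsogenous _ _ hiso').2
      ⟨A', hA', B', hB', hdet', rfl⟩
    obtain ⟨M, hMP⟩ : ∃ M : GL ((Fin 1 ⊕ Fin 1) ⊕ (Fin 1 ⊕ Fin 1)) ℝ,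
        (M : Matrix _ _ ℝ) =
          Matrix.reindex ((finSumFinEquiv (m := 1) (n := 1)).symm.sumCongr (finSumFinEquiv (m := 1) (n := 1)).symm)
            ((finSumFinEquiv (m := 1) (n := 1)).symm.sumCongr (finSumFinEquiv (m := 1) (n := 1)).symm)
            (blockDiagGL (Fin 2) (Fin 2) ℝ (A', B') : Matrix (Fin 2 ⊕ Fin 2) (Fin 2 ⊕ Fin 2) ℝ) :=
      ⟨Matrix.GeneralLinearGroup.mk'' _ (by
          rw [Matrix.det_reindex_self]
          exact (Matrix.isUnit_iff_isUnit_det _).1 (blockDiagGL (Fin 2) (Fin 2) ℝ (A', B')).isUnit), rfl⟩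
    refine ⟨M, (mem_mumfordTateGroup_prod_prinPeriod_one_iff Z₁ Z₂).2 ⟨_, hP, hMP.symm⟩, ?_⟩
    rw [hMP, hN, coe_blockDiagGL, reindex_sumCongr_fromBlocks_zero, hA'A, hB'B]

/-- **EVERY BLOCK SUM `reindex_ε (A 0; 0 B)` WITH `A ∈ MT(X_{Z₁})(ℝ)`, `B ∈ MT(X_{Z₂})(ℝ)`, `det A = det B` LIES IN
`MT(X_{(τ₁ 0; 0 τ₂)})(ℝ)`** for non-isogenous elliptic blocks — g30-#11's inclusion into the determinant fibre product is an
equality here. [cite: Moonen2004MT, §5 (5.6) Exercise (p. 12)] [cite: Lombardo2019, §2.2, case 5 (arXiv:1610.09674 p. 4)] -/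
theorem reindex_fromBlocks_mem_mumfordTateGroup_prinPeriod_blockDiagPoint_of_not_isIsogenous
    (h₁ : ∀ i, ε (Sum.inl (Sum.inl i)) = Sum.inl (e (Sum.inl i))) (h₂ : ∀ i, ε (Sum.inl (Sum.inr i)) = Sum.inr (e (Sum.inl i)))
    (h₃ : ∀ j, ε (Sum.inr (Sum.inl j)) = Sum.inl (e (Sum.inr j))) (h₄ : ∀ j, ε (Sum.inr (Sum.inr j)) = Sum.inr (e (Sum.inr j)))
    (hiso : ¬ IsIsogenous (prinPeriod Z₁) (prinPeriod Z₂)) {A B : GL (Fin 1 ⊕ Fin 1) ℝ}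
    (hA : A ∈ mumfordTateGroup (prinPeriod Z₁)) (hB : B ∈ mumfordTateGroup (prinPeriod Z₂))
    (hdet : (A : Matrix (Fin 1 ⊕ Fin 1) (Fin 1 ⊕ Fin 1) ℝ).det = (B : Matrix (Fin 1 ⊕ Fin 1) (Fin 1 ⊕ Fin 1) ℝ).det)
    {N : GL (Fin g ⊕ Fin g) ℝ}
    (hN : (N : Matrix (Fin g ⊕ Fin g) (Fin g ⊕ Fin g) ℝ) = Matrix.reindex ε ε (fromBlocks (A : Matrix _ _ ℝ) 0 0 (B : Matrix _ _ ℝ))) :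
    N ∈ mumfordTateGroup (prinPeriod (blockDiagPoint e Z₁ Z₂)) :=
  (mem_mumfordTateGroup_prinPeriod_blockDiagPoint_one_one_iff_of_not_isIsogenous e Z₁ Z₂ h₁ h₂ h₃ h₄ hiso).2
    ⟨A, hA, B, hB, hdet, hN⟩

end NonIsogenous

end SiegelModuli

end Literature.AlgebraicGeometry.ModuliOfAbelianVarieties
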